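import Literature.AlgebraicGeometry.AbelianSchemes.AbelianSchemePowReindex
import HarnessLib

/-!
# Composition law of Serre's tensor construction: `(A ⊗_𝒪 𝔞) ⊗_𝒪 𝔟 ≅ A ⊗_𝒪 (𝔞 ⊗_𝒪 𝔟)` via the Kronecker presentation

Topic `AlgebraicGeometry/AbelianSchemes`, namespace `Literature.AlgebraicGeometry.AbelianSchemes.AbelianSchemeOver` (constructions with
bodies + proved theorems; no named fact, no `sorry`, no `instance`, no notation; any base `S`).  Cell `hodgecm-mathlib`, F0/P6 «MOD»,
P6a organ (g2) FILE 6b (FILE 2 ★ `SerreTensorConstruction`, FILE 3 ★ `SerreTensorFunctoriality`, FILE 5 `SerreTensorPresentation`,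
FILE 6a `AbelianSchemePowReindex`); `--supports stmt-HodgeConjecture-24832`, count-neutral.  HC_CM is proved only modulo the 2 remaining
named inputs (hLiu418, h413) until rung 0 closes; this file discharges none of them.

## Mathematics

Let `A/S` be an abelian scheme with commutative group law and an action `ι : 𝒪 → End(A)`, and let `𝔞 = E·𝒪ⁿ`, `𝔟 = F·𝒪ᵐ` be finite
projective `𝒪`-modules presented by idempotent matrices `E ∈ Mₙ(𝒪)`, `F ∈ Mₘ(𝒪)` (`E² = E`, `F² = F`).  Then `𝔟 ⊗_𝒪 𝔞` is presented by
the Kronecker idempotent `G = F ⊗ₖ E ∈ M_{m·n}(𝒪)` (`G_{(i,k),(j,k')} = F_{ij} E_{kk'}`, reindexed along `Fin m × Fin n ≃ Fin (m·n)`), and the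
iterated construction `(A ⊗_𝒪 𝔞) ⊗_𝒪 𝔟 = Fix([F]₁ ∣ Fix([E])ᵐ)` (with `[F]₁` the matrix of `F` for the induced action on `A ⊗_𝒪 𝔞`) is
identified with `A ⊗_𝒪 (𝔟 ⊗ 𝔞) = Fix([G] ∣ A^{m·n})` by `ι₂ ≫ (ι₁)ᵐ ≫ ((Aⁿ)ᵐ ≅ A^{m·n}) ≫ π_G`, with inverse `ι_G ≫ (≅)⁻¹ ≫ (π₁)ᵐ ≫ π₂`.
The two identities that make this work are (K1) `(ι₁)ᵐ ≫ R ≫ [G] = [F]₁ ≫ (ι₁)ᵐ ≫ R` (on `Fix([E])ᵐ` the Kronecker matrix restricts to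
`[F]₁`, because `ι₁ ≫ [a·1ₙ] = ι(a)₁ ≫ ι₁` and `ι₁ ≫ [E] = ι₁`) and (K4) `([E])ᵐ ≫ R = R ≫ [1 ⊗ₖ E]` together with
`(F ⊗ₖ E)(1 ⊗ₖ E) = F ⊗ₖ E`.  This is the associativity `(M ⊗_R N) ⊗_R A ≅ M ⊗_R (N ⊗_R A)` of B. Conrad, *Gross–Zagier revisited* §7
(Serre's tensor construction is a functor in the module, compatible with `⊗`), made explicit on presentations.

## Contents

* §1 `prod_fin_mul_eq` (products over `Fin (m·n)` as double products), `matrixComp_scalar`, `matrixEnd_scalar_powProj`,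
  `matrixEnd_scalar_eq_powMap` (`[a·1ₙ] = (ι a)ⁿ`), `powMap_powMap_comp_powPowIso` (naturality of `(Aⁿ)ᵐ ≅ A^{m·n}`);
* §2 `kronPres E F : Matrix (Fin (m*n)) (Fin (m*n)) O` (`kronPres_apply`, `kronPres_idem`, `kron_mul_kron_one`), `serreComm`, **`serreTensorIter
  act E hE F hF`** (= `(A ⊗_𝒪 𝔞) ⊗_𝒪 𝔟`), (K1) `powMap_ι_comp_kron`, (K4) `powMap_matrixEnd_comp_powPowIso`;
* §3 `serreCompHom`, `serreCompInv`, `serreCompHom_inv`, `serreCompInv_hom`, **`serreTensorCompIso act E hE F hF :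
  (serreTensorIter act E hE F hF).X ≅ (serreTensor act (kronPres E F) (kronPres_idem E hE F hF)).X`**, `isMonHom_serreTensorCompIso`,
  `serreCompHom_ι`, **`serreCompHom_equivariant`** ∕ `serreTensorCompIso_equivariant` (`𝒪`-equivariance).

## References
* [Conrad2004GrossZagier] B. Conrad, *Gross–Zagier revisited*, MSRI Publ. 49 (2004), §7 («The Serre tensor construction»).
* [Kottwitz1992] §5 (p. 390); [MumfordFogartyKirwan1994] Ch. 6 §1 Def. 6.1, Cor. 6.4.
* Tree: ★ FILE 2∕3 and FILE 6a `AbelianSchemePowReindex` (`powPowIso`).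
-/

noncomputable section

universe u

open CategoryTheory CategoryTheory.Limits AlgebraicGeometry MonoidalCategory CartesianMonoidalCategory
open scoped MonObj Kronecker

namespace Literature.AlgebraicGeometry.AbelianSchemes

namespace AbelianSchemeOver

variable {S : Scheme.{u}} {A : AbelianSchemeOver S} {O : Type*} [CommRing O] (act : A.RingAction O) [IsCommMonObj A.X]
  {m n : ℕ}

/-! ## §1 Products over `Fin (m·n)` as double products; scalar matrices on coordinates -/

/-- `∏_{l < m n} f l = ∏_i ∏_k f (finProdFinEquiv (i, k))`. [cite: Kottwitz1992, §5 (p. 390)] -/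
theorem prod_fin_mul_eq {M : Type*} [CommMonoid M] (f : Fin (m * n) → M) :
    ∏ l, f l = ∏ i : Fin m, ∏ k : Fin n, f (finProdFinEquiv (i, k)) := by
  rw [← Fintype.prod_prod_type', ← Fintype.prod_equiv finProdFinEquiv (fun p => f (finProdFinEquiv p)) f (fun _ => rfl)]

/-- The coordinates of the scalar matrix: `(x ≫ [a·1])_k = x_k ≫ ι(a)`. [cite: Kottwitz1992, §5 (p. 390)] -/
theorem matrixComp_scalar (a : O) {T : Over S} (x : Fin n → (T ⟶ A.X)) (k : Fin n) :
    matrixComp act (Matrix.scalar (Fin n) a) x k = x k ≫ act.i a := by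
  unfold matrixComp
  rw [Finset.prod_eq_single k (fun l _ hlk => by rw [Matrix.scalar_apply, Matrix.diagonal_apply_ne _ (Ne.symm hlk), act.i_zero,
      MonObj.comp_one]) (fun h => absurd (Finset.mem_univ k) h), Matrix.scalar_apply, Matrix.diagonal_apply_eq]

/-- `[a·1] ≫ pr_k = pr_k ≫ ι(a)`. [cite: Kottwitz1992, §5 (p. 390)] -/
@[reassoc]
theorem matrixEnd_scalar_powProj (a : O) (k : Fin n) :
    matrixEnd act (Matrix.scalar (Fin n) a) ≫ A.powProj n k = A.powProj n k ≫ act.i a := by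
  have h := congrFun (powHomEquiv_matrixEnd act (Matrix.scalar (Fin n) a)) k
  rw [powHomEquiv_apply, matrixComp_scalar] at h
  exact h

/-- `[a·1ₙ] = (ι a)ⁿ`: a scalar matrix acts coordinatewise. [cite: Kottwitz1992, §5 (p. 390)] -/
theorem matrixEnd_scalar_eq_powMap (a : O) : matrixEnd act (Matrix.scalar (Fin n) a) = powMap (act.i a) n :=
  pow_hom_ext fun k => by rw [matrixEnd_scalar_powProj, powMap_powProj]

omit [IsCommMonObj A.X] in
/-- Naturality of `(Aⁿ)ᵐ ≅ A^{m·n}` in a morphism `g : A → A′`: `(gⁿ)ᵐ ≫ R′ = R ≫ g^{m·n}`.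
[cite: MumfordFogartyKirwan1994, Ch. 6 §1 Definition 6.1 (p. 115)] -/
@[reassoc]
theorem powMap_powMap_comp_powPowIso {A' : AbelianSchemeOver S} (g : A.X ⟶ A'.X) :
    powMap (powMap g n) m ≫ (A'.powPowIso m n).hom = (A.powPowIso m n).hom ≫ powMap g (m * n) := by
  apply pow_hom_ext
  intro l
  obtain ⟨⟨i, k⟩, rfl⟩ := finProdFinEquiv.surjective l
  simp only [Category.assoc, powPowIso_hom_powProj, powPowIso_hom_powProj_assoc, powMap_powProj, powMap_powProj_assoc, powPowProj]

variable (E : Matrix (Fin n) (Fin n) O) (hE : E * E = E) (F : Matrix (Fin m) (Fin m) O) (hF : F * F = F)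

/-! ## §2 The Kronecker presentation `G = F ⊗ₖ E` on `A^{m·n}` and the two intertwining identities -/

/-- The Kronecker presentation `G := (F ⊗ₖ E)` reindexed along `Fin m × Fin n ≃ Fin (m·n)` (a presentation of `𝔞 ⊗_𝒪 𝔟` for
`𝔞 = E·𝒪ⁿ`, `𝔟 = F·𝒪ᵐ`). [cite: Conrad2004GrossZagier, §7] -/
def kronPres : Matrix (Fin (m * n)) (Fin (m * n)) O := Matrix.reindex finProdFinEquiv finProdFinEquiv (F ⊗ₖ E)

/-- Entries of the Kronecker presentation: `G_{(i,k),(j,k')} = F_{ij} E_{kk'}`. [cite: Conrad2004GrossZagier, §7] -/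
@[simp] theorem kronPres_apply (i j : Fin m) (k k' : Fin n) :
    kronPres E F (finProdFinEquiv (i, k)) (finProdFinEquiv (j, k')) = F i j * E k k' := by
  simp [kronPres, Matrix.reindex_apply, Matrix.submatrix_apply, Matrix.kroneckerMap_apply]

include hE hF in
/-- `G` is idempotent when `E`, `F` are. [cite: Conrad2004GrossZagier, §7] -/
theorem kronPres_idem : kronPres E F * kronPres E F = kronPres E F := by
  unfold kronPres
  rw [Matrix.reindex_apply, Matrix.submatrix_mul_equiv (F ⊗ₖ E) (F ⊗ₖ E) _ finProdFinEquiv.symm _, ← Matrix.mul_kronecker_mul, hF, hE]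

/-- `Fix([E]) = A ⊗_𝒪 𝔞` is commutative (instance by name, for the iterated construction). [cite: Conrad2004GrossZagier, §7] -/
abbrev serreComm : IsCommMonObj (serreTensor act E hE).X := isCommMonObj_serreTensor act E hE

/-- **The iterated construction `(A ⊗_𝒪 𝔞) ⊗_𝒪 𝔟`** (`𝔞 = E·𝒪ⁿ`, `𝔟 = F·𝒪ᵐ`), with the induced action on `A ⊗_𝒪 𝔞`.
[cite: Conrad2004GrossZagier, §7] -/
abbrev serreTensorIter : AbelianSchemeOver S :=
  @serreTensor S (serreTensor act E hE) O _ (serreAction act E hE) (serreComm act E hE) m F hF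

/-- **(K1)** `Jᵐ ≫ R ≫ [G] = [F]₁ ≫ Jᵐ ≫ R` on `(A ⊗ 𝔞)ᵐ`: under `(ι₁)ᵐ : (A ⊗ 𝔞)ᵐ ↪ (Aⁿ)ᵐ ≅ A^{m·n}` the Kronecker matrix `[G]` restricts
to the matrix `[F]₁` for the induced action. [cite: Conrad2004GrossZagier, §7] -/
@[reassoc]
theorem powMap_ι_comp_kron :
    powMap (serreι act E hE) m ≫ (A.powPowIso m n).hom ≫ matrixEnd act (kronPres E F) =
      @matrixEnd S (serreTensor act E hE) O _ (serreAction act E hE) (serreComm act E hE) m F ≫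
        powMap (serreι act E hE) m ≫ (A.powPowIso m n).hom := by
  haveI := serreComm act E hE
  haveI := (isMonHom_serreι_serreπ act E hE).1
  haveI : ∀ a, IsMonHom (act.i a) := act.isMonHom
  apply pow_hom_ext
  intro l
  obtain ⟨⟨i, k⟩, rfl⟩ := finProdFinEquiv.surjective l
  haveI := A.isMonHom_powProj n k
  -- LEFT: coordinate (i,k) of `J ≫ R ≫ [G]`
  have hL := congrFun (powHomEquiv_comp_matrixEnd act (kronPres E F) (powMap (serreι act E hE) m ≫ (A.powPowIso m n).hom))
    (finProdFinEquiv (i, k))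
  simp only [powHomEquiv_apply, Category.assoc] at hL
  -- RIGHT: coordinate i of `[F]₁`
  have hR := congrFun (powHomEquiv_comp_matrixEnd (serreAction act E hE) F (𝟙 ((serreTensor act E hE).pow m).X)) i
  rw [powHomEquiv_apply, Category.id_comp] at hR
  simp only [Category.assoc]
  rw [hL, powPowIso_hom_powProj, powPowProj, powMap_powProj_assoc, reassoc_of% hR]
  unfold matrixComp
  rw [prod_fin_mul_eq, finset_prod_comp]
  refine Finset.prod_congr rfl fun j _ => ?_
  -- the j-th factor: `pr_j ≫ ι₁` is fixed by `[E]`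
  have hfix := congrFun (powHomEquiv_comp_matrixEnd act E ((serreTensor act E hE).powProj m j ≫ serreι act E hE)) k
  rw [Category.assoc, serreι_comp_matrixEnd] at hfix
  simp only [powHomEquiv_apply, Category.assoc] at hfix
  simp only [powHomEquiv_apply, Category.id_comp, Category.assoc]
  rw [serreAction_i_comp_ι_assoc, matrixEnd_scalar_powProj, reassoc_of% hfix]
  unfold matrixComp
  rw [finset_prod_comp]
  refine Finset.prod_congr rfl fun k' _ => ?_
  simp only [powHomEquiv_apply, kronPres_apply, powPowIso_hom_powProj_assoc, powPowProj, Category.assoc, powMap_powProj_assoc,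
    act.i_mul]

/-- **(K4)** `([E])ᵐ ≫ R = R ≫ [1 ⊗ₖ E]`: the coordinatewise action of `E` on `(Aⁿ)ᵐ` is the Kronecker matrix `1 ⊗ₖ E` on `A^{m·n}`.
[cite: Conrad2004GrossZagier, §7] -/
@[reassoc]
theorem powMap_matrixEnd_comp_powPowIso :
    powMap (matrixEnd act E) m ≫ (A.powPowIso m n).hom = (A.powPowIso m n).hom ≫ matrixEnd act (kronPres E (1 : Matrix (Fin m) (Fin m) O)) := by
  haveI := isMonHom_matrixEnd act E
  apply pow_hom_ext
  intro l
  obtain ⟨⟨i, k⟩, rfl⟩ := finProdFinEquiv.surjective l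
  have hL := congrFun (powHomEquiv_comp_matrixEnd act E ((A.pow n).powProj m i)) k
  rw [powHomEquiv_apply] at hL
  have hR := congrFun (powHomEquiv_comp_matrixEnd act (kronPres E (1 : Matrix (Fin m) (Fin m) O)) (A.powPowIso m n).hom)
    (finProdFinEquiv (i, k))
  rw [powHomEquiv_apply] at hR
  rw [Category.assoc, powPowIso_hom_powProj, powPowProj, powMap_powProj_assoc, ← Category.assoc, hL, hR]
  unfold matrixComp
  rw [prod_fin_mul_eq, Finset.prod_eq_single i (fun j _ hji => ?_) (fun h => absurd (Finset.mem_univ i) h)]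
  · refine Finset.prod_congr rfl fun k' _ => ?_
    rw [kronPres_apply, Matrix.one_apply_eq, one_mul, powHomEquiv_apply, powHomEquiv_apply, powPowIso_hom_powProj, powPowProj]
  · refine Finset.prod_eq_one fun k' _ => ?_
    rw [kronPres_apply, Matrix.one_apply_ne' hji, zero_mul, act.i_zero, MonObj.comp_one]

include hE in
/-- `[1 ⊗ₖ E] ≫ [F ⊗ₖ E] = [F ⊗ₖ E]` (`(F ⊗ E)(1 ⊗ E) = F ⊗ E²`). [cite: Conrad2004GrossZagier, §7] -/
theorem kron_mul_kron_one : kronPres E F * kronPres E (1 : Matrix (Fin m) (Fin m) O) = kronPres E F := by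
  unfold kronPres
  rw [Matrix.reindex_apply, Matrix.reindex_apply, Matrix.submatrix_mul_equiv (F ⊗ₖ E) ((1 : Matrix (Fin m) (Fin m) O) ⊗ₖ E) _
      finProdFinEquiv.symm _, ← Matrix.mul_kronecker_mul, Matrix.mul_one, hE]

/-! ## §3 The isomorphism `(A ⊗_𝒪 𝔞) ⊗_𝒪 𝔟 ≅ A ⊗_𝒪 (𝔞 ⊗ 𝔟)` -/

/-- `(A ⊗ 𝔞) ⊗ 𝔟 ⟶ A ⊗ (𝔞 ⊗ 𝔟)`: `ι₂ ≫ (ι₁)ᵐ ≫ R ≫ π₃`. [cite: Conrad2004GrossZagier, §7] -/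
def serreCompHom : (serreTensorIter act E hE F hF).X ⟶ (serreTensor act (kronPres E F) (kronPres_idem E hE F hF)).X :=
  @serreι S (serreTensor act E hE) O _ (serreAction act E hE) (serreComm act E hE) m F hF ≫
    powMap (serreι act E hE) m ≫ (A.powPowIso m n).hom ≫ serreπ act (kronPres E F) (kronPres_idem E hE F hF)

/-- `A ⊗ (𝔞 ⊗ 𝔟) ⟶ (A ⊗ 𝔞) ⊗ 𝔟`: `ι₃ ≫ R⁻¹ ≫ (π₁)ᵐ ≫ π₂`. [cite: Conrad2004GrossZagier, §7] -/
def serreCompInv : (serreTensor act (kronPres E F) (kronPres_idem E hE F hF)).X ⟶ (serreTensorIter act E hE F hF).X :=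
  serreι act (kronPres E F) (kronPres_idem E hE F hF) ≫ (A.powPowIso m n).inv ≫ powMap (serreπ act E hE) m ≫
    @serreπ S (serreTensor act E hE) O _ (serreAction act E hE) (serreComm act E hE) m F hF

/-- `serreCompHom ≫ serreCompInv = 𝟙`. [cite: Conrad2004GrossZagier, §7] -/
theorem serreCompHom_inv : serreCompHom act E hE F hF ≫ serreCompInv act E hE F hF = 𝟙 _ := by
  haveI := serreComm act E hE
  have h1 := serreπ_ι_and_ι_π act (kronPres E F) (kronPres_idem E hE F hF)
  have h2 := @serreπ_ι_and_ι_π S (serreTensor act E hE) O _ (serreAction act E hE) (serreComm act E hE) m F hF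
  have h3 : powMap (serreι act E hE) m ≫ powMap (serreπ act E hE) m = 𝟙 _ := by
    rw [← powMap_comp, (serreπ_ι_and_ι_π act E hE).2, powMap_id]
  unfold serreCompHom serreCompInv
  simp only [Category.assoc]
  rw [reassoc_of% h1.1, powMap_ι_comp_kron_assoc, Iso.hom_inv_id_assoc, reassoc_of% h3,
    @serreι_comp_matrixEnd_assoc S (serreTensor act E hE) O _ (serreAction act E hE) (serreComm act E hE) m F hF, h2.2]

/-- `serreCompInv ≫ serreCompHom = 𝟙`. [cite: Conrad2004GrossZagier, §7] -/
theorem serreCompInv_hom : serreCompInv act E hE F hF ≫ serreCompHom act E hE F hF = 𝟙 _ := by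
  haveI := serreComm act E hE
  have h1 := serreπ_ι_and_ι_π act (kronPres E F) (kronPres_idem E hE F hF)
  have h2 := @serreπ_ι_and_ι_π S (serreTensor act E hE) O _ (serreAction act E hE) (serreComm act E hE) m F hF
  have h3 : powMap (serreπ act E hE) m ≫ powMap (serreι act E hE) m = powMap (matrixEnd act E) m := by
    rw [← powMap_comp, (serreπ_ι_and_ι_π act E hE).1]
  unfold serreCompHom serreCompInv
  simp only [Category.assoc]
  rw [reassoc_of% h2.1, ← powMap_ι_comp_kron_assoc, reassoc_of% h3, powMap_matrixEnd_comp_powPowIso_assoc, Iso.inv_hom_id_assoc,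
    reassoc_of% (matrixEnd_mul act (kronPres E F) (kronPres E (1 : Matrix (Fin m) (Fin m) O))).symm,
    kron_mul_kron_one E hE F, ← h1.1, Category.assoc, reassoc_of% h1.2, h1.2]

/-- **`(A ⊗_𝒪 𝔞) ⊗_𝒪 𝔟 ≅ A ⊗_𝒪 (𝔞 ⊗_𝒪 𝔟)`** for `𝔞 = E·𝒪ⁿ`, `𝔟 = F·𝒪ᵐ`, `𝔞 ⊗ 𝔟 = (F ⊗ₖ E)·𝒪^{m·n}` (the composition law making the
monoid of finitely generated projective modules — for a Dedekind `𝒪`, the ideal CLASS GROUP — act through Serre's construction).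
[cite: Conrad2004GrossZagier, §7] -/
def serreTensorCompIso : (serreTensorIter act E hE F hF).X ≅ (serreTensor act (kronPres E F) (kronPres_idem E hE F hF)).X where
  hom := serreCompHom act E hE F hF
  inv := serreCompInv act E hE F hF
  hom_inv_id := serreCompHom_inv act E hE F hF
  inv_hom_id := serreCompInv_hom act E hE F hF

/-- Both directions of the composition isomorphism are homomorphisms. [cite: Conrad2004GrossZagier, §7] -/
theorem isMonHom_serreTensorCompIso :
    IsMonHom (serreTensorCompIso act E hE F hF).hom ∧ IsMonHom (serreTensorCompIso act E hE F hF).inv := by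
  haveI := serreComm act E hE
  haveI := (isMonHom_serreι_serreπ act E hE).1
  haveI := (isMonHom_serreι_serreπ act (kronPres E F) (kronPres_idem E hE F hF)).2.1
  haveI := (@isMonHom_serreι_serreπ S (serreTensor act E hE) O _ (serreAction act E hE) (serreComm act E hE) m F hF).1
  haveI := isMonHom_powMap (serreι act E hE) m
  haveI := (A.isMonHom_powPowIso m n).1
  haveI h : IsMonHom (serreTensorCompIso act E hE F hF).hom := by
    change IsMonHom (serreCompHom act E hE F hF)
    unfold serreCompHom
    infer_instance
  exact ⟨h, inferInstance⟩

/-- `serreCompHom ≫ ι_G = ι₂ ≫ (ι₁)ᵐ ≫ R`: the composition isomorphism is compatible with the embeddings into `A^{m·n}`.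
[cite: Conrad2004GrossZagier, §7] -/
@[reassoc]
theorem serreCompHom_ι : serreCompHom act E hE F hF ≫ serreι act (kronPres E F) (kronPres_idem E hE F hF) =
    @serreι S (serreTensor act E hE) O _ (serreAction act E hE) (serreComm act E hE) m F hF ≫
      powMap (serreι act E hE) m ≫ (A.powPowIso m n).hom := by
  haveI := serreComm act E hE
  unfold serreCompHom
  simp only [Category.assoc]
  rw [(serreπ_ι_and_ι_π act (kronPres E F) (kronPres_idem E hE F hF)).1, powMap_ι_comp_kron,
    @serreι_comp_matrixEnd_assoc S (serreTensor act E hE) O _ (serreAction act E hE) (serreComm act E hE) m F hF]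

/-- **`𝒪`-equivariance of the composition isomorphism**: `ι₂₁(a) ≫ serreCompHom = serreCompHom ≫ ι_G(a)` for the induced actions on
`(A ⊗_𝒪 𝔞) ⊗_𝒪 𝔟` and on `A ⊗_𝒪 (𝔞 ⊗ 𝔟)`. [cite: Conrad2004GrossZagier, §7] -/
theorem serreCompHom_equivariant (a : O) :
    (@serreAction S (serreTensor act E hE) O _ (serreAction act E hE) (serreComm act E hE) m F hF).i a ≫ serreCompHom act E hE F hF =
      serreCompHom act E hE F hF ≫ (serreAction act (kronPres E F) (kronPres_idem E hE F hF)).i a := by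
  haveI := serreComm act E hE
  haveI := (isMonHom_serreι_serreπ act (kronPres E F) (kronPres_idem E hE F hF)).2.2
  rw [← cancel_mono (serreι act (kronPres E F) (kronPres_idem E hE F hF))]
  simp only [Category.assoc]
  rw [serreAction_i_comp_ι, serreCompHom_ι_assoc, serreCompHom_ι,
    @serreAction_i_comp_ι_assoc S (serreTensor act E hE) O _ (serreAction act E hE) (serreComm act E hE) m F hF,
    matrixEnd_scalar_eq_powMap, matrixEnd_scalar_eq_powMap,
    ← reassoc_of% (powMap_comp ((serreAction act E hE).i a) m (serreι act E hE)), serreAction_i_comp_ι,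
    matrixEnd_scalar_eq_powMap, reassoc_of% (powMap_comp (serreι act E hE) m (powMap (act.i a) n)),
    powMap_powMap_comp_powPowIso]

/-- `𝒪`-equivariance of `serreTensorCompIso`. [cite: Conrad2004GrossZagier, §7] -/
theorem serreTensorCompIso_equivariant (a : O) :
    (@serreAction S (serreTensor act E hE) O _ (serreAction act E hE) (serreComm act E hE) m F hF).i a ≫
        (serreTensorCompIso act E hE F hF).hom =
      (serreTensorCompIso act E hE F hF).hom ≫ (serreAction act (kronPres E F) (kronPres_idem E hE F hF)).i a :=
  serreCompHom_equivariant act E hE F hF a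

end AbelianSchemeOver

end Literature.AlgebraicGeometry.AbelianSchemes

end
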